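import Summits.Ventures.YMGap.RobustBall.RobustStarDoorW
import Summits.Ventures.YMGap.RobustBall.TorusRowsSU3Star
import Summits.Ventures.YMGap.RobustBall.TorusRowsSU3StarCertifiedDim3
import Summits.Ventures.YMGap.RobustBall.TorusRowsSU3StarCertifiedDim4
import HarnessLib

/-!
# Venture YMGap, track ROBUST-BALL (Y2) — crux Y2-X2-W, step W6: the `SU(2)`, `d = 4` ROWS of the robust
# vertex-star door on the TIER-2 (weighted, infinite-range) torus ball `ClusterDomain κ (2ε) ε`

HONEST FRAMING. WHAT THIS IS: a venture file (cell `pub-ymgap`, track Y2 ROBUST-BALL, seat ds-2): numeric instances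
of `RobustStarDoorW` for `SU(2)` on the tree's QUARTER one-link modulus `OneLinkKRModulus 2 (3β_W/2) 1`
(`β_W ≤ 2/3`, `K = 1`, robust coefficient `c ≥ e^{2ε}(1 + 2√2 ε) β_W/4`, `λ ≥ √2 ε`, Neumann depth `20`) on the
one-parameter TIER-2 balls `ClusterDomain κ (2ε) ε` (`e^{κ·diam}`-weighted loads; NO range cut-off, any polymers):
every row is an exact-rational certificate `doorPoly 4 c < 1 ∧ θ < 1 ∧ T₁·(R_G^{(4)}(c) + (T₂λ + θ^{20}·16·T₂λ)/(1−θ)) < 1`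
(`θ = 6c + λ`, `T₁ ≥ e^{t}`, `T₂ ≥ e^{2t}`) checked by `norm_num`, with `e^{2ε}`, `e^{t}`, `√2` replaced by certified
decimal majorants. ROWS (β_W, ε), all HYPOTHESIS-FREE, class K, currency `TorusClusteringOnBallW 2 4 (β/…) κ (2ε) ε A t`
(torus clustering at RATE `t` per lattice unit with constant `A = 16 e^{2t}`, uniform in `L ≥ 3`, in the member and in
`0 ≤ β ≤ β_W/2`): at `t = 1/100` for EVERY weight `κ ≥ 1/100`: (1/8, .146) (1/6, .110) (1/5, .085) (1/4, .054)
(3/10, .027) (1/3, .011); at the lineage weight `κ = t = log(6/5)`: (1/8, .110) (1/4, .033) (3/10, .010);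
at `κ = t = log(3/2)`: (1/8, .068) (1/4, .012). BEFORE: the tier-2 torus rows came from the single-link door only
(`su2_torusClusteringOnBallW_quarter`, Wilson threshold `2e^{−κ}/9`): (1/8, log 6/5, .086), (1/8, log 3/2, .036), nothing
at `β_W ≥ 0.185` (resp. `0.148`). WHAT THIS IS NOT: radii and rates are artefacts of the door (the radius vanishes at the
star threshold `e^{t}R_G = 1`, i.e. `β_W = 0.3609` as `t → 0`); torus currency only; nothing about the continuum limit
or the Millennium problem.

## References
* The tree: `RobustStarDoorW.lean` (this seat), `TorusRowsSU2Star.lean` (the tier-1 twin; majorant lemmas),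
  `TorusRowsSU2.lean` (`sqrt_two_le`), `Thresholds/StarResolventDim.lean` (`gaugeR`, `doorPoly`).
-/

noncomputable section

open Finset
open Literature.MathematicalPhysics.QuantumLattice (fundamentalRep)
open Literature.MathematicalPhysics.QuantumFieldTheory hiding ZdEdge
open Literature.MathematicalPhysics.QuantumFieldTheory.Balaban1983to89.StrongCouplingTorusWindow
open Literature.MathematicalPhysics.QuantumFieldTheory.Balaban1983to89.StrongCouplingDobrushinWindow
  (OneLinkKRModulus OneLinkKRModulusSU2)
open Summit.Ventures.YMGap.StarResolventDim (Delta gaugeR doorPoly Delta_pos_of_door gaugeR_lt_one_of_door)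

namespace Summit.Ventures.YMGap.RobustBall

/-! ### Certified decimal majorants -/

/-- `e^{1 / 100} ≤ 1010051 / 1000000` (Mathlib's `Real.exp_bound'`, five terms). [folklore] -/
theorem exp_le_1_100_w : Real.exp (1 / 100) ≤ 1010051 / 1000000 := by
  have h := Real.exp_bound' (x := 1 / 100) (by norm_num) (by norm_num) (n := 5) (by norm_num)
  refine h.trans ?_
  simp only [Finset.sum_range_succ, Finset.sum_range_zero, Nat.factorial]
  norm_num

/-- `e^{1 / 50} ≤ 510101 / 500000` (Mathlib's `Real.exp_bound'`, five terms). [folklore] -/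
theorem exp_le_1_50_w : Real.exp (1 / 50) ≤ 510101 / 500000 := by
  have h := Real.exp_bound' (x := 1 / 50) (by norm_num) (by norm_num) (n := 5) (by norm_num)
  refine h.trans ?_
  simp only [Finset.sum_range_succ, Finset.sum_range_zero, Nat.factorial]
  norm_num

/-- `e^{73 / 250} ≤ 669553 / 500000` (Mathlib's `Real.exp_bound'`, five terms). [folklore] -/
theorem exp_le_73_250_w : Real.exp (73 / 250) ≤ 669553 / 500000 := by
  have h := Real.exp_bound' (x := 73 / 250) (by norm_num) (by norm_num) (n := 5) (by norm_num)
  refine h.trans ?_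
  simp only [Finset.sum_range_succ, Finset.sum_range_zero, Nat.factorial]
  norm_num

/-- `e^{11 / 50} ≤ 623039 / 500000` (Mathlib's `Real.exp_bound'`, five terms). [folklore] -/
theorem exp_le_11_50_w : Real.exp (11 / 50) ≤ 623039 / 500000 := by
  have h := Real.exp_bound' (x := 11 / 50) (by norm_num) (by norm_num) (n := 5) (by norm_num)
  refine h.trans ?_
  simp only [Finset.sum_range_succ, Finset.sum_range_zero, Nat.factorial]
  norm_num

/-- `e^{27 / 250} ≤ 17407 / 15625` (Mathlib's `Real.exp_bound'`, five terms). [folklore] -/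
theorem exp_le_27_250_w : Real.exp (27 / 250) ≤ 17407 / 15625 := by
  have h := Real.exp_bound' (x := 27 / 250) (by norm_num) (by norm_num) (n := 5) (by norm_num)
  refine h.trans ?_
  simp only [Finset.sum_range_succ, Finset.sum_range_zero, Nat.factorial]
  norm_num

/-- `e^{27 / 500} ≤ 211097 / 200000` (Mathlib's `Real.exp_bound'`, five terms). [folklore] -/
theorem exp_le_27_500_w : Real.exp (27 / 500) ≤ 211097 / 200000 := by
  have h := Real.exp_bound' (x := 27 / 500) (by norm_num) (by norm_num) (n := 5) (by norm_num)
  refine h.trans ?_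
  simp only [Finset.sum_range_succ, Finset.sum_range_zero, Nat.factorial]
  norm_num

/-- `e^{17 / 125} ≤ 572841 / 500000` (Mathlib's `Real.exp_bound'`, five terms). [folklore] -/
theorem exp_le_17_125_w : Real.exp (17 / 125) ≤ 572841 / 500000 := by
  have h := Real.exp_bound' (x := 17 / 125) (by norm_num) (by norm_num) (n := 5) (by norm_num)
  refine h.trans ?_
  simp only [Finset.sum_range_succ, Finset.sum_range_zero, Nat.factorial]
  norm_num

/-! ### The schema: `SU(2)`, `d = 4`, tier-2 ball, weighted robust star door -/

/-- `2(2√2)² e^{2t} = 16 e^{2t}`. [folklore] -/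
theorem two_mul_sq_two_sqrt_two (t : ℝ) :
    2 * (2 * Real.sqrt ((2 : ℕ) : ℝ)) ^ 2 * Real.exp (2 * t) = 16 * Real.exp (2 * t) := by
  rw [show ((2 : ℕ) : ℝ) = 2 by norm_num, mul_pow, Real.sq_sqrt (by norm_num : (0 : ℝ) ≤ 2)]
  ring

/-- **SCHEMA, `SU(2)`, `d = 4`: torus clustering on the TIER-2 ball `ClusterDomain κ ε₀ ε₁` through the WEIGHTED
ROBUST STAR DOOR**, at rate `t` (`0 ≤ t ≤ κ`) with constant `16 e^{2t}`, uniformly in `L ≥ 3` and in the tree coupling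
`0 ≤ β ≤ β_W/2` (`0 < β_W ≤ 2/3`): given decimal majorants `e^{ε₀} ≤ E`, `√2 ≤ S`, `e^{t} ≤ T₁`, `e^{2t} ≤ T₂`, a
coefficient `c ≥ E(1 + 2Sε₁)β_W/4`, `λ ≥ Sε₁`, and the three rational inequalities `doorPoly 4 c < 1`, `6c + λ < 1`,
`T₁·(gaugeR 4 c + (T₂λ + (6c+λ)^K·16·T₂λ)/(1 − (6c+λ))) < 1`. [folklore] -/
theorem su2_torusClusteringOnBallW_star (Kn : ℕ) {βW κ ε₀ ε₁ c lam E S t T₁ T₂ : ℝ} (hβ0 : 0 < βW)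
    (hβ : βW ≤ 2 / 3) (hε₁ : 0 ≤ ε₁) (ht : 0 ≤ t) (htκ : t ≤ κ) (hE : Real.exp ε₀ ≤ E) (hS : Real.sqrt 2 ≤ S)
    (hT₁ : Real.exp t ≤ T₁) (hT₂ : Real.exp (2 * t) ≤ T₂) (hc : E * (1 + 2 * S * ε₁) * (βW / 4) ≤ c)
    (hlam : S * ε₁ ≤ lam) (hθ1 : 6 * c + lam < 1) (hcd : doorPoly 4 c < 1)
    (hρ1 : T₁ * (gaugeR 4 c + (T₂ * lam + (6 * c + lam) ^ Kn * (16 * (T₂ * lam))) / (1 - (6 * c + lam))) < 1) :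
    ∀ β : ℝ, 0 ≤ β → β ≤ βW / 2 → TorusClusteringOnBallW 2 4 β κ ε₀ ε₁ (16 * Real.exp (2 * t)) t := by
  have hS0 : 0 ≤ S := (Real.sqrt_nonneg _).trans hS
  have hE0 : 0 ≤ E := (Real.exp_pos _).le.trans hE
  have hc0 : 0 ≤ c := le_trans (by positivity) hc
  have hlam0 : 0 ≤ lam := le_trans (by positivity) hlam
  set θ : ℝ := 6 * c + lam with hθ
  set ρ : ℝ := Real.exp t * (gaugeR 4 c +
    (Real.exp (2 * t) * lam + θ ^ Kn * (16 * (Real.exp (2 * t) * lam))) / (1 - θ)) with hρ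
  have hθ0 : 0 ≤ θ := by positivity
  have h1θ : 0 < 1 - θ := by linarith
  have hgR := gaugeR_lt_one_of_door (d := 4) (by norm_num) hc0 hcd
  have hθK : 0 ≤ θ ^ Kn := pow_nonneg hθ0 Kn
  have hin0 : 0 ≤ gaugeR 4 c + (Real.exp (2 * t) * lam + θ ^ Kn * (16 * (Real.exp (2 * t) * lam))) / (1 - θ) :=
    add_nonneg hgR.1 (div_nonneg (by positivity) h1θ.le)
  have hin : gaugeR 4 c + (Real.exp (2 * t) * lam + θ ^ Kn * (16 * (Real.exp (2 * t) * lam))) / (1 - θ) ≤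
      gaugeR 4 c + (T₂ * lam + θ ^ Kn * (16 * (T₂ * lam))) / (1 - θ) := by
    have h1 : Real.exp (2 * t) * lam ≤ T₂ * lam := mul_le_mul_of_nonneg_right hT₂ hlam0
    have h2 : θ ^ Kn * (16 * (Real.exp (2 * t) * lam)) ≤ θ ^ Kn * (16 * (T₂ * lam)) :=
      mul_le_mul_of_nonneg_left (by linarith) hθK
    exact add_le_add le_rfl (div_le_div_of_nonneg_right (add_le_add h1 h2) h1θ.le)
  have hρ1' : ρ < 1 :=
    calc ρ ≤ T₁ * (gaugeR 4 c + (T₂ * lam + θ ^ Kn * (16 * (T₂ * lam))) / (1 - θ)) :=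
          mul_le_mul hT₁ hin hin0 ((Real.exp_pos _).le.trans hT₁)
      _ < 1 := hρ1
  have hR : βW / 2 / ((2 : ℕ) : ℝ) * (2 * (((4 : ℕ) : ℝ) - 1)) ≤ 3 * βW / 2 := by push_cast; linarith
  have hc' : (1 : ℝ) * Real.exp ε₀ * (1 + 2 * Real.sqrt ((2 : ℕ) : ℝ) * ε₁) * (βW / 2 / ((2 : ℕ) : ℝ)) ≤ c := by
    refine le_trans ?_ hc
    have h1 : Real.sqrt ((2 : ℕ) : ℝ) = Real.sqrt 2 := by norm_num
    rw [h1, one_mul]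
    have h4 : βW / 2 / ((2 : ℕ) : ℝ) = βW / 4 := by push_cast; ring
    rw [h4]
    have hb : 0 ≤ βW / 4 := by positivity
    calc Real.exp ε₀ * (1 + 2 * Real.sqrt 2 * ε₁) * (βW / 4) ≤ E * (1 + 2 * Real.sqrt 2 * ε₁) * (βW / 4) := by
          gcongr
      _ ≤ E * (1 + 2 * S * ε₁) * (βW / 4) := by gcongr
  have hlam' : Real.sqrt ((2 : ℕ) : ℝ) * ε₁ ≤ lam := by
    have h1 : Real.sqrt ((2 : ℕ) : ℝ) = Real.sqrt 2 := by norm_num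
    rw [h1]; exact le_trans (mul_le_mul_of_nonneg_right hS hε₁) hlam
  have hθ' : θ = (2 * ((4 : ℕ) : ℝ) - 2) * c + lam := by rw [hθ]; push_cast; ring
  have hρ' : ρ = Real.exp t * (gaugeR 4 c +
      (Real.exp (2 * t) * lam + θ ^ Kn * (4 * ((4 : ℕ) : ℝ) * (Real.exp (2 * t) * lam))) / (1 - θ)) := by
    rw [hρ]; push_cast; ring
  have h := torusClusteringOnBallW_upTo_of_robustStar (d := 4) (N := 2) (by norm_num) (by norm_num) Kn zero_le_one
    hR (su2_quarterModulus hβ) hε₁ ht htκ hc' hlam' hθ' hθ1 hcd hρ' hρ1'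
  rw [two_mul_sq_two_sqrt_two] at h
  exact h

/-! ### The rows -/

/-- **TIER-2 ROW `(β_W, ε) = (1 / 8, 73 / 500)`, `SU(2)`, `d = 4`, WEIGHTED ROBUST STAR DOOR**, rate `1/100` per lattice unit, EVERY weight `κ ≥ 1/100`: every member
of the weighted ball `ClusterDomain κ (73 / 250) (73 / 500)` (no range cut-off, any polymers) clusters exponentially at rate
`1 / 100` on every torus `(ℤ/L)⁴`, `L ≥ 3`, at every tree coupling `0 ≤ β ≤ 1 / 16` (certificate: `c = 7391 / 125000`,
`λ = 206477 / 1000000`, `ρ ≈ 0.9961`); HYPOTHESIS-FREE. [folklore] -/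
theorem su2_torusClusteringOnBallW_star_oneEighth_t100 :
    ∀ κ : ℝ, 1 / 100 ≤ κ → ∀ β : ℝ, 0 ≤ β → β ≤ 1 / 16 →
      TorusClusteringOnBallW 2 4 β κ (73 / 250) (73 / 500) (16 * Real.exp (1 / 50)) (1 / 100) := by
  intro κ hκ
  have e1 : (1 / 8 : ℝ) / 2 = 1 / 16 := by norm_num
  have h := su2_torusClusteringOnBallW_star 20 (βW := 1 / 8) (κ := κ) (ε₀ := 73 / 250) (ε₁ := 73 / 500)
    (c := 7391 / 125000) (lam := 206477 / 1000000) (t := 1 / 100) (T₁ := 1010051 / 1000000) (T₂ := 510101 / 500000)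
    (by norm_num) (by norm_num) (by norm_num) (by norm_num) hκ exp_le_73_250_w sqrt_two_le
    exp_le_1_100_w (by rw [show (2:ℝ) * (1 / 100) = 1 / 50 by norm_num]; exact exp_le_1_50_w)
    (by norm_num) (by norm_num) (by norm_num) (by unfold doorPoly; norm_num)
    (by unfold gaugeR Delta; norm_num)
  have e2 : (2 : ℝ) * (1 / 100) = 1 / 50 := by norm_num
  rw [e1, e2] at h
  exact h

/-- **TIER-2 ROW `(β_W, ε) = (1 / 6, 11 / 100)`, `SU(2)`, `d = 4`, WEIGHTED ROBUST STAR DOOR**, rate `1/100` per lattice unit, EVERY weight `κ ≥ 1/100`: every member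
of the weighted ball `ClusterDomain κ (11 / 50) (11 / 100)` (no range cut-off, any polymers) clusters exponentially at rate
`1 / 100` on every torus `(ℤ/L)⁴`, `L ≥ 3`, at every tree coupling `0 ≤ β ≤ 1 / 12` (certificate: `c = 34037 / 500000`,
`λ = 31113 / 200000`, `ρ ≈ 0.9973`); HYPOTHESIS-FREE. [folklore] -/
theorem su2_torusClusteringOnBallW_star_oneSixth_t100 :
    ∀ κ : ℝ, 1 / 100 ≤ κ → ∀ β : ℝ, 0 ≤ β → β ≤ 1 / 12 →
      TorusClusteringOnBallW 2 4 β κ (11 / 50) (11 / 100) (16 * Real.exp (1 / 50)) (1 / 100) := by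
  intro κ hκ
  have e1 : (1 / 6 : ℝ) / 2 = 1 / 12 := by norm_num
  have h := su2_torusClusteringOnBallW_star 20 (βW := 1 / 6) (κ := κ) (ε₀ := 11 / 50) (ε₁ := 11 / 100)
    (c := 34037 / 500000) (lam := 31113 / 200000) (t := 1 / 100) (T₁ := 1010051 / 1000000) (T₂ := 510101 / 500000)
    (by norm_num) (by norm_num) (by norm_num) (by norm_num) hκ exp_le_11_50_w sqrt_two_le
    exp_le_1_100_w (by rw [show (2:ℝ) * (1 / 100) = 1 / 50 by norm_num]; exact exp_le_1_50_w)
    (by norm_num) (by norm_num) (by norm_num) (by unfold doorPoly; norm_num)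
    (by unfold gaugeR Delta; norm_num)
  have e2 : (2 : ℝ) * (1 / 100) = 1 / 50 := by norm_num
  rw [e1, e2] at h
  exact h

/-- **TIER-2 ROW `(β_W, ε) = (1 / 5, 17 / 200)`, `SU(2)`, `d = 4`, WEIGHTED ROBUST STAR DOOR**, rate `1/100` per lattice unit, EVERY weight `κ ≥ 1/100`: every member
of the weighted ball `ClusterDomain κ (17 / 100) (17 / 200)` (no range cut-off, any polymers) clusters exponentially at rate
`1 / 100` on every torus `(ℤ/L)⁴`, `L ≥ 3`, at every tree coupling `0 ≤ β ≤ 1 / 10` (certificate: `c = 36757 / 500000`,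
`λ = 120209 / 1000000`, `ρ ≈ 0.9925`); HYPOTHESIS-FREE. [folklore] -/
theorem su2_torusClusteringOnBallW_star_oneFifth_t100 :
    ∀ κ : ℝ, 1 / 100 ≤ κ → ∀ β : ℝ, 0 ≤ β → β ≤ 1 / 10 →
      TorusClusteringOnBallW 2 4 β κ (17 / 100) (17 / 200) (16 * Real.exp (1 / 50)) (1 / 100) := by
  intro κ hκ
  have e1 : (1 / 5 : ℝ) / 2 = 1 / 10 := by norm_num
  have h := su2_torusClusteringOnBallW_star 20 (βW := 1 / 5) (κ := κ) (ε₀ := 17 / 100) (ε₁ := 17 / 200)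
    (c := 36757 / 500000) (lam := 120209 / 1000000) (t := 1 / 100) (T₁ := 1010051 / 1000000) (T₂ := 510101 / 500000)
    (by norm_num) (by norm_num) (by norm_num) (by norm_num) hκ exp_le_17_100_cstar3 sqrt_two_le
    exp_le_1_100_w (by rw [show (2:ℝ) * (1 / 100) = 1 / 50 by norm_num]; exact exp_le_1_50_w)
    (by norm_num) (by norm_num) (by norm_num) (by unfold doorPoly; norm_num)
    (by unfold gaugeR Delta; norm_num)
  have e2 : (2 : ℝ) * (1 / 100) = 1 / 50 := by norm_num
  rw [e1, e2] at h
  exact h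

/-- **TIER-2 ROW `(β_W, ε) = (1 / 4, 27 / 500)`, `SU(2)`, `d = 4`, WEIGHTED ROBUST STAR DOOR**, rate `1/100` per lattice unit, EVERY weight `κ ≥ 1/100`: every member
of the weighted ball `ClusterDomain κ (27 / 250) (27 / 500)` (no range cut-off, any polymers) clusters exponentially at rate
`1 / 100` on every torus `(ℤ/L)⁴`, `L ≥ 3`, at every tree coupling `0 ≤ β ≤ 1 / 8` (certificate: `c = 80263 / 1000000`,
`λ = 4773 / 62500`, `ρ ≈ 0.9987`); HYPOTHESIS-FREE. [folklore] -/
theorem su2_torusClusteringOnBallW_star_oneQuarter_t100 :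
    ∀ κ : ℝ, 1 / 100 ≤ κ → ∀ β : ℝ, 0 ≤ β → β ≤ 1 / 8 →
      TorusClusteringOnBallW 2 4 β κ (27 / 250) (27 / 500) (16 * Real.exp (1 / 50)) (1 / 100) := by
  intro κ hκ
  have e1 : (1 / 4 : ℝ) / 2 = 1 / 8 := by norm_num
  have h := su2_torusClusteringOnBallW_star 20 (βW := 1 / 4) (κ := κ) (ε₀ := 27 / 250) (ε₁ := 27 / 500)
    (c := 80263 / 1000000) (lam := 4773 / 62500) (t := 1 / 100) (T₁ := 1010051 / 1000000) (T₂ := 510101 / 500000)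
    (by norm_num) (by norm_num) (by norm_num) (by norm_num) hκ exp_le_27_250_w sqrt_two_le
    exp_le_1_100_w (by rw [show (2:ℝ) * (1 / 100) = 1 / 50 by norm_num]; exact exp_le_1_50_w)
    (by norm_num) (by norm_num) (by norm_num) (by unfold doorPoly; norm_num)
    (by unfold gaugeR Delta; norm_num)
  have e2 : (2 : ℝ) * (1 / 100) = 1 / 50 := by norm_num
  rw [e1, e2] at h
  exact h

/-- **TIER-2 ROW `(β_W, ε) = (3 / 10, 27 / 1000)`, `SU(2)`, `d = 4`, WEIGHTED ROBUST STAR DOOR**, rate `1/100` per lattice unit, EVERY weight `κ ≥ 1/100`: every member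
of the weighted ball `ClusterDomain κ (27 / 500) (27 / 1000)` (no range cut-off, any polymers) clusters exponentially at rate
`1 / 100` on every torus `(ℤ/L)⁴`, `L ≥ 3`, at every tree coupling `0 ≤ β ≤ 3 / 20` (certificate: `c = 85207 / 1000000`,
`λ = 4773 / 125000`, `ρ ≈ 0.9976`); HYPOTHESIS-FREE. [folklore] -/
theorem su2_torusClusteringOnBallW_star_threeTenths_t100 :
    ∀ κ : ℝ, 1 / 100 ≤ κ → ∀ β : ℝ, 0 ≤ β → β ≤ 3 / 20 →
      TorusClusteringOnBallW 2 4 β κ (27 / 500) (27 / 1000) (16 * Real.exp (1 / 50)) (1 / 100) := by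
  intro κ hκ
  have e1 : (3 / 10 : ℝ) / 2 = 3 / 20 := by norm_num
  have h := su2_torusClusteringOnBallW_star 20 (βW := 3 / 10) (κ := κ) (ε₀ := 27 / 500) (ε₁ := 27 / 1000)
    (c := 85207 / 1000000) (lam := 4773 / 125000) (t := 1 / 100) (T₁ := 1010051 / 1000000) (T₂ := 510101 / 500000)
    (by norm_num) (by norm_num) (by norm_num) (by norm_num) hκ exp_le_27_500_w sqrt_two_le
    exp_le_1_100_w (by rw [show (2:ℝ) * (1 / 100) = 1 / 50 by norm_num]; exact exp_le_1_50_w)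
    (by norm_num) (by norm_num) (by norm_num) (by unfold doorPoly; norm_num)
    (by unfold gaugeR Delta; norm_num)
  have e2 : (2 : ℝ) * (1 / 100) = 1 / 50 := by norm_num
  rw [e1, e2] at h
  exact h

/-- **TIER-2 ROW `(β_W, ε) = (1 / 3, 11 / 1000)`, `SU(2)`, `d = 4`, WEIGHTED ROBUST STAR DOOR**, rate `1/100` per lattice unit, EVERY weight `κ ≥ 1/100`: every member
of the weighted ball `ClusterDomain κ (11 / 500) (11 / 1000)` (no range cut-off, any polymers) clusters exponentially at rate
`1 / 100` on every torus `(ℤ/L)⁴`, `L ≥ 3`, at every tree coupling `0 ≤ β ≤ 1 / 6` (certificate: `c = 43919 / 500000`,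
`λ = 15557 / 1000000`, `ρ ≈ 0.9964`); HYPOTHESIS-FREE. [folklore] -/
theorem su2_torusClusteringOnBallW_star_oneThird_t100 :
    ∀ κ : ℝ, 1 / 100 ≤ κ → ∀ β : ℝ, 0 ≤ β → β ≤ 1 / 6 →
      TorusClusteringOnBallW 2 4 β κ (11 / 500) (11 / 1000) (16 * Real.exp (1 / 50)) (1 / 100) := by
  intro κ hκ
  have e1 : (1 / 3 : ℝ) / 2 = 1 / 6 := by norm_num
  have h := su2_torusClusteringOnBallW_star 20 (βW := 1 / 3) (κ := κ) (ε₀ := 11 / 500) (ε₁ := 11 / 1000)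
    (c := 43919 / 500000) (lam := 15557 / 1000000) (t := 1 / 100) (T₁ := 1010051 / 1000000) (T₂ := 510101 / 500000)
    (by norm_num) (by norm_num) (by norm_num) (by norm_num) hκ exp_le_11_500_cstar3 sqrt_two_le
    exp_le_1_100_w (by rw [show (2:ℝ) * (1 / 100) = 1 / 50 by norm_num]; exact exp_le_1_50_w)
    (by norm_num) (by norm_num) (by norm_num) (by unfold doorPoly; norm_num)
    (by unfold gaugeR Delta; norm_num)
  have e2 : (2 : ℝ) * (1 / 100) = 1 / 50 := by norm_num
  rw [e1, e2] at h
  exact h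

/-- **TIER-2 ROW `(β_W, ε) = (1 / 8, 11 / 100)`, `SU(2)`, `d = 4`, WEIGHTED ROBUST STAR DOOR**, the lineage weight and rate `κ = t = log(6/5)`: every member
of the weighted ball `ClusterDomain κ (11 / 50) (11 / 100)` (no range cut-off, any polymers) clusters exponentially at rate
`Real.log (6 / 5)` on every torus `(ℤ/L)⁴`, `L ≥ 3`, at every tree coupling `0 ≤ β ≤ 1 / 16` (certificate: `c = 3191 / 62500`,
`λ = 31113 / 200000`, `ρ ≈ 0.9948`); HYPOTHESIS-FREE. [folklore] -/
theorem su2_torusClusteringOnBallW_star_oneEighth_w65 :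
    ∀ β : ℝ, 0 ≤ β → β ≤ 1 / 16 →
      TorusClusteringOnBallW 2 4 β (Real.log (6 / 5)) (11 / 50) (11 / 100) (16 * Real.exp (2 * Real.log (6 / 5))) (Real.log (6 / 5)) := by
  have e1 : (1 / 8 : ℝ) / 2 = 1 / 16 := by norm_num
  have h := su2_torusClusteringOnBallW_star 20 (βW := 1 / 8) (κ := Real.log (6 / 5)) (ε₀ := 11 / 50) (ε₁ := 11 / 100)
    (c := 3191 / 62500) (lam := 31113 / 200000) (t := Real.log (6 / 5)) (T₁ := 6 / 5) (T₂ := 36 / 25)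
    (by norm_num) (by norm_num) (by norm_num) (Real.log_nonneg (by norm_num)) le_rfl exp_le_11_50_w sqrt_two_le
    (by rw [Real.exp_log (by norm_num)]) (by rw [show (2:ℝ) * Real.log (6 / 5) = Real.log ((6 / 5) ^ 2) by rw [Real.log_pow]; norm_num, Real.exp_log (by norm_num)]; norm_num)
    (by norm_num) (by norm_num) (by norm_num) (by unfold doorPoly; norm_num)
    (by unfold gaugeR Delta; norm_num)
  rw [e1] at h
  exact h

/-- **TIER-2 ROW `(β_W, ε) = (1 / 4, 33 / 1000)`, `SU(2)`, `d = 4`, WEIGHTED ROBUST STAR DOOR**, the lineage weight and rate `κ = t = log(6/5)`: every member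
of the weighted ball `ClusterDomain κ (33 / 500) (33 / 1000)` (no range cut-off, any polymers) clusters exponentially at rate
`Real.log (6 / 5)` on every torus `(ℤ/L)⁴`, `L ≥ 3`, at every tree coupling `0 ≤ β ≤ 1 / 8` (certificate: `c = 18249 / 250000`,
`λ = 4667 / 100000`, `ρ ≈ 0.9907`); HYPOTHESIS-FREE. [folklore] -/
theorem su2_torusClusteringOnBallW_star_oneQuarter_w65 :
    ∀ β : ℝ, 0 ≤ β → β ≤ 1 / 8 →
      TorusClusteringOnBallW 2 4 β (Real.log (6 / 5)) (33 / 500) (33 / 1000) (16 * Real.exp (2 * Real.log (6 / 5))) (Real.log (6 / 5)) := by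
  have e1 : (1 / 4 : ℝ) / 2 = 1 / 8 := by norm_num
  have h := su2_torusClusteringOnBallW_star 20 (βW := 1 / 4) (κ := Real.log (6 / 5)) (ε₀ := 33 / 500) (ε₁ := 33 / 1000)
    (c := 18249 / 250000) (lam := 4667 / 100000) (t := Real.log (6 / 5)) (T₁ := 6 / 5) (T₂ := 36 / 25)
    (by norm_num) (by norm_num) (by norm_num) (Real.log_nonneg (by norm_num)) le_rfl exp_le_33_500_cstar3 sqrt_two_le
    (by rw [Real.exp_log (by norm_num)]) (by rw [show (2:ℝ) * Real.log (6 / 5) = Real.log ((6 / 5) ^ 2) by rw [Real.log_pow]; norm_num, Real.exp_log (by norm_num)]; norm_num)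
    (by norm_num) (by norm_num) (by norm_num) (by unfold doorPoly; norm_num)
    (by unfold gaugeR Delta; norm_num)
  rw [e1] at h
  exact h

/-- **TIER-2 ROW `(β_W, ε) = (3 / 10, 1 / 100)`, `SU(2)`, `d = 4`, WEIGHTED ROBUST STAR DOOR**, the lineage weight and rate `κ = t = log(6/5)`: every member
of the weighted ball `ClusterDomain κ (1 / 50) (1 / 100)` (no range cut-off, any polymers) clusters exponentially at rate
`Real.log (6 / 5)` on every torus `(ℤ/L)⁴`, `L ≥ 3`, at every tree coupling `0 ≤ β ≤ 3 / 20` (certificate: `c = 1967 / 25000`,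
`λ = 14143 / 1000000`, `ρ ≈ 0.9904`); HYPOTHESIS-FREE. [folklore] -/
theorem su2_torusClusteringOnBallW_star_threeTenths_w65 :
    ∀ β : ℝ, 0 ≤ β → β ≤ 3 / 20 →
      TorusClusteringOnBallW 2 4 β (Real.log (6 / 5)) (1 / 50) (1 / 100) (16 * Real.exp (2 * Real.log (6 / 5))) (Real.log (6 / 5)) := by
  have e1 : (3 / 10 : ℝ) / 2 = 3 / 20 := by norm_num
  have h := su2_torusClusteringOnBallW_star 20 (βW := 3 / 10) (κ := Real.log (6 / 5)) (ε₀ := 1 / 50) (ε₁ := 1 / 100)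
    (c := 1967 / 25000) (lam := 14143 / 1000000) (t := Real.log (6 / 5)) (T₁ := 6 / 5) (T₂ := 36 / 25)
    (by norm_num) (by norm_num) (by norm_num) (Real.log_nonneg (by norm_num)) le_rfl exp_le_1_50_w sqrt_two_le
    (by rw [Real.exp_log (by norm_num)]) (by rw [show (2:ℝ) * Real.log (6 / 5) = Real.log ((6 / 5) ^ 2) by rw [Real.log_pow]; norm_num, Real.exp_log (by norm_num)]; norm_num)
    (by norm_num) (by norm_num) (by norm_num) (by unfold doorPoly; norm_num)
    (by unfold gaugeR Delta; norm_num)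
  rw [e1] at h
  exact h

/-- **TIER-2 ROW `(β_W, ε) = (1 / 8, 17 / 250)`, `SU(2)`, `d = 4`, WEIGHTED ROBUST STAR DOOR**, the weight and rate `κ = t = log(3/2)`: every member
of the weighted ball `ClusterDomain κ (17 / 125) (17 / 250)` (no range cut-off, any polymers) clusters exponentially at rate
`Real.log (3 / 2)` on every torus `(ℤ/L)⁴`, `L ≥ 3`, at every tree coupling `0 ≤ β ≤ 1 / 16` (certificate: `c = 42689 / 1000000`,
`λ = 96167 / 1000000`, `ρ ≈ 0.9907`); HYPOTHESIS-FREE. [folklore] -/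
theorem su2_torusClusteringOnBallW_star_oneEighth_w32 :
    ∀ β : ℝ, 0 ≤ β → β ≤ 1 / 16 →
      TorusClusteringOnBallW 2 4 β (Real.log (3 / 2)) (17 / 125) (17 / 250) (16 * Real.exp (2 * Real.log (3 / 2))) (Real.log (3 / 2)) := by
  have e1 : (1 / 8 : ℝ) / 2 = 1 / 16 := by norm_num
  have h := su2_torusClusteringOnBallW_star 20 (βW := 1 / 8) (κ := Real.log (3 / 2)) (ε₀ := 17 / 125) (ε₁ := 17 / 250)
    (c := 42689 / 1000000) (lam := 96167 / 1000000) (t := Real.log (3 / 2)) (T₁ := 3 / 2) (T₂ := 9 / 4)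
    (by norm_num) (by norm_num) (by norm_num) (Real.log_nonneg (by norm_num)) le_rfl exp_le_17_125_w sqrt_two_le
    (by rw [Real.exp_log (by norm_num)]) (by rw [show (2:ℝ) * Real.log (3 / 2) = Real.log ((3 / 2) ^ 2) by rw [Real.log_pow]; norm_num, Real.exp_log (by norm_num)]; norm_num)
    (by norm_num) (by norm_num) (by norm_num) (by unfold doorPoly; norm_num)
    (by unfold gaugeR Delta; norm_num)
  rw [e1] at h
  exact h

/-- **TIER-2 ROW `(β_W, ε) = (1 / 4, 3 / 250)`, `SU(2)`, `d = 4`, WEIGHTED ROBUST STAR DOOR**, the weight and rate `κ = t = log(3/2)`: every member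
of the weighted ball `ClusterDomain κ (3 / 125) (3 / 250)` (no range cut-off, any polymers) clusters exponentially at rate
`Real.log (3 / 2)` on every torus `(ℤ/L)⁴`, `L ≥ 3`, at every tree coupling `0 ≤ β ≤ 1 / 8` (certificate: `c = 4137 / 62500`,
`λ = 16971 / 1000000`, `ρ ≈ 0.9937`); HYPOTHESIS-FREE. [folklore] -/
theorem su2_torusClusteringOnBallW_star_oneQuarter_w32 :
    ∀ β : ℝ, 0 ≤ β → β ≤ 1 / 8 →
      TorusClusteringOnBallW 2 4 β (Real.log (3 / 2)) (3 / 125) (3 / 250) (16 * Real.exp (2 * Real.log (3 / 2))) (Real.log (3 / 2)) := by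
  have e1 : (1 / 4 : ℝ) / 2 = 1 / 8 := by norm_num
  have h := su2_torusClusteringOnBallW_star 20 (βW := 1 / 4) (κ := Real.log (3 / 2)) (ε₀ := 3 / 125) (ε₁ := 3 / 250)
    (c := 4137 / 62500) (lam := 16971 / 1000000) (t := Real.log (3 / 2)) (T₁ := 3 / 2) (T₂ := 9 / 4)
    (by norm_num) (by norm_num) (by norm_num) (Real.log_nonneg (by norm_num)) le_rfl exp_le_3_125_star sqrt_two_le
    (by rw [Real.exp_log (by norm_num)]) (by rw [show (2:ℝ) * Real.log (3 / 2) = Real.log ((3 / 2) ^ 2) by rw [Real.log_pow]; norm_num, Real.exp_log (by norm_num)]; norm_num)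
    (by norm_num) (by norm_num) (by norm_num) (by unfold doorPoly; norm_num)
    (by unfold gaugeR Delta; norm_num)
  rw [e1] at h
  exact h

end Summit.Ventures.YMGap.RobustBall

end
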